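import Summits.AtomisticToContinuum.HydrodynamicLimit.Theorems.CollisionIsometryCLTCollisionalTransferLocalityBalanceIdentity
import Literature.MathematicalPhysics.KineticTheory.HardSphereEuler
import Literature.Analysis.FluidPDE.CollisionalTransferTimeDep
import Literature.Analysis.FluidPDE.CollisionalTransfer
import Literature.Analysis.FluidPDE.HardSphereCollisionRecord
import Literature.Analysis.FunctionSpaces.TorusSpaceTime
import HarnessLib

/-!
# Pathwise entropy production in `collisionSum` form (stub `stub_pathwise`)

Crux `Summit.AtomisticToContinuum.HydrodynamicLimit.Theses.OneFlightGossipEngine.ClampedCurrentsDock`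
(stmt-AtomisticToContinuum-14680), line `IdeatorTwoSketch`, registered stub
`stub_pathwise : PathwiseEntropyProduction` (re-declared verbatim from the line skeleton
`Cruxes/ClampedCurrentsDock/Lines/IdeatorTwoSketch.lean`): step (i) of Yau's relative-entropy clock for
deterministic hard spheres. Along a good orbit of the hard-sphere flow (`N+1` spheres of diameter
`hsDiameter σ N` on `𝕋³`) the one-body local-Gibbs exponent `Σ_i g_t(x_i, v_i)`,
`g = log a − (3/2) log(2πθ) − |v − u|²/(2θ)` with profiles jointly smooth on `[0, T) × 𝕋³`, changes over
a window `[s, s+h] ⊆ [0, T)` by the streaming integral of `(∂_t + v·∇)g` plus the collision sum of the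
pair kernel `½{[(u/θ)(x_i) − (u/θ)(x_j)]·Δv_i − [θ⁻¹(x_i) − θ⁻¹(x_j)]Δe_i}` over the ORDERED contact pairs.

Proof: the weak balance law for a time-dependent observable LOCALIZED to the window (the tree's
`IsHardSphereTrajectory.sub_eq_integral_add_finsum_collisionJump_td` asks global-in-time derivatives while
the profiles are smooth on `[0, T)` only; the localized induction is
`HemisphereAffineSlaving.BalanceIdentity.sub_eq_integral_add_finsum_collisionJump_loc`, Spohn 1991 Part I
§3.2 (3.3)–(3.8)) for `F t w = Σ_i g_t(w_i)`, whose streaming derivative along free flight is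
`Σ_i Dg_t(w_i)` by the chain rule through the space–time lift (`hasDerivAt_slice_freeFlight`: at interior
times the one-sided `Torus.timeDerivWithin (Ico 0 T)` is the two-sided derivative; the slices
`(t, x) ↦ g_t(x, v)` are jointly smooth since `a, θ > 0`), `F, F'` being continuous in time along free
flight up to the window's endpoints; at a binary collision the positions and the other particles do not
jump, contact is symmetric on the torus (so the ordered contact pairs are the colliding pair in its two
orders, with no regularity hypothesis on the diameter), and momentum/energy conservation in the pair
(`vel_add_vel_eq_leftLim`, `norm_sq_vel_add_eq_leftLim`) turn the jump of the kinetic part into the pair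
kernel summed over the two orders (`jump_algebra`, `collisionJump_gSum`).
-/

noncomputable section

namespace Summit.AtomisticToContinuum.HydrodynamicLimit.Theorems.ClampedCurrentsDockPathwise

open scoped BigOperators ENNReal Classical InnerProductSpace
open MeasureTheory Filter Set Topology
open Literature.MathematicalPhysics.KineticTheory Literature.Analysis.FluidPDE Literature.Analysis.FunctionSpaces
open Summit.AtomisticToContinuum.HydrodynamicLimit.Theorems.HemisphereAffineSlaving.BalanceIdentity
  (sub_eq_integral_add_finsum_collisionJump_loc torus_continuous_translate)

/-! ## The statement (verbatim from the line skeleton) -/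

/-- **S2 — pathwise entropy production in `collisionSum` form.** For the hard-sphere flow of `N+1` spheres of
diameter `hsDiameter σ N` on `𝕋³` (`0 < σ ≤ 1/2`), profiles `a, θ > 0`, `u` jointly smooth on `[0,T) × 𝕋³`,
a good initial datum `z` and a window `[s, s+h] ⊆ [0,T)`: with the one-body exponent
`g_t(x,v) = log a_t(x) − (3/2) log(2π θ_t(x)) − |v − u_t(x)|²/(2θ_t(x))` and its streaming rate
`Dg_t(x,v) = ∂_t g + Σ_k v_k ∂_k g` (torus calculus, `timeDerivWithin (Ico 0 T)` / `partialDeriv`),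
`Σ_i g_{s+h}((Φ_{s+h}z)_i) − Σ_i g_s((Φ_s z)_i) = ∫_s^{s+h} Σ_i Dg_r((Φ_r z)_i) dr +
collisionSum_{(s,s+h]} ½{Σ_k [(u_k/θ)(x_fst) − (u_k/θ)(x_snd)] Δv_fst,k − [θ⁻¹(x_fst) − θ⁻¹(x_snd)] Δe_fst}`,
`Δv_fst = v_fst⁺ − v_fst⁻`, `Δe_fst = (|v_fst⁺|² − |v_fst⁻|²)/2` (profiles frozen at the collision time).
The position part of `g` does not jump; the kinetic part is `momentumObservable (u/θ) − energyObservable θ⁻¹`,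
whose jumps are `collisionJump_momentumObservable` / `collisionJump_energyObservable`. -/
def PathwiseEntropyProduction : Prop :=
  ∀ (σ T : ℝ) (N : ℕ) (Φ : HardSphereFlow (Torus.geometry (Fin 3)) (hsDiameter σ N) (N + 1))
    (a θ : ℝ → T3 → ℝ) (u : ℝ → T3 → V3), 0 < σ → σ ≤ 1 / 2 →
    Torus.IsSmoothSpaceTimeOn (Ico 0 T) a → Torus.IsSmoothSpaceTimeOn (Ico 0 T) θ →
    Torus.IsSmoothSpaceTimeOn (Ico 0 T) u →
    (∀ t ∈ Ico 0 T, ∀ x, 0 < a t x) → (∀ t ∈ Ico 0 T, ∀ x, 0 < θ t x) →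
    ∀ z ∈ Φ.good, ∀ s h : ℝ, 0 ≤ s → 0 ≤ h → s + h < T →
      (let g := fun (t : ℝ) (y : T3 × V3) =>
         Real.log (a t y.1) - 3 / 2 * Real.log (2 * Real.pi * θ t y.1) - ‖y.2 - u t y.1‖ ^ 2 / (2 * θ t y.1)
       let Dg := fun (t : ℝ) (y : T3 × V3) =>
         Torus.timeDerivWithin (Ico 0 T) (fun t' x => g t' (x, y.2)) t y.1 +
           ∑ k : Fin 3, y.2 k * Torus.partialDeriv k (fun x => g t (x, y.2)) y.1
       (∑ i : Fin (N + 1), g (s + h) ((Φ.flow (s + h) z) i)) - ∑ i : Fin (N + 1), g s ((Φ.flow s z) i) =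
         (∫ r in s..(s + h), ∑ i : Fin (N + 1), Dg r ((Φ.flow r z) i)) +
           Φ.collisionSum (Set.Ioc s (s + h)) (fun c =>
             ((∑ k : Fin 3, (u c.time c.fstPos k / θ c.time c.fstPos - u c.time c.sndPos k / θ c.time c.sndPos) *
                 (c.postVel.1 k - c.preVel.1 k)) -
               ((θ c.time c.fstPos)⁻¹ - (θ c.time c.sndPos)⁻¹) * ((‖c.postVel.1‖ ^ 2 - ‖c.preVel.1‖ ^ 2) / 2)) / 2) z)

/-! ## The exponent, its streaming rate, the observable and the pair kernel -/

section Defs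

variable {N : ℕ}

/-- The one-body local-Gibbs exponent `g_t(x, v) = log a_t(x) − (3/2) log(2π θ_t(x)) − |v − u_t(x)|²/(2θ_t(x))`.
[folklore] -/
def gExp (a θ : ℝ → T3 → ℝ) (u : ℝ → T3 → V3) (t : ℝ) (y : T3 × V3) : ℝ :=
  Real.log (a t y.1) - 3 / 2 * Real.log (2 * Real.pi * θ t y.1) - ‖y.2 - u t y.1‖ ^ 2 / (2 * θ t y.1)

/-- The streaming rate `Dg_t(x, v) = ∂_t g + Σ_k v_k ∂_k g` of the exponent (one-sided time derivative
within `[0, T)`). [folklore] -/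
def DgExp (T : ℝ) (a θ : ℝ → T3 → ℝ) (u : ℝ → T3 → V3) (t : ℝ) (y : T3 × V3) : ℝ :=
  Torus.timeDerivWithin (Ico 0 T) (fun t' x => gExp a θ u t' (x, y.2)) t y.1 +
    ∑ k : Fin 3, y.2 k * Torus.partialDeriv k (fun x => gExp a θ u t (x, y.2)) y.1

/-- The observable `F_t(w) = Σ_i g_t(w_i)`. [folklore] -/
def gSum (a θ : ℝ → T3 → ℝ) (u : ℝ → T3 → V3) (t : ℝ) (w : Config (N + 1) (Fin 3) T3) : ℝ :=
  ∑ i, gExp a θ u t (w i)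

/-- Its streaming derivative `F'_t(w) = Σ_i Dg_t(w_i)`. [folklore] -/
def DgSum (T : ℝ) (a θ : ℝ → T3 → ℝ) (u : ℝ → T3 → V3) (t : ℝ) (w : Config (N + 1) (Fin 3) T3) : ℝ :=
  ∑ i, DgExp T a θ u t (w i)

/-- The pair kernel `½{Σ_k [(u_k/θ)(x_fst) − (u_k/θ)(x_snd)] Δv_fst,k − [θ⁻¹(x_fst) − θ⁻¹(x_snd)] Δe_fst}` of
a collision record (profiles frozen at the collision time). [folklore] -/
def pairKernel (θ : ℝ → T3 → ℝ) (u : ℝ → T3 → V3) (c : HardSphereCollisionRecord (Fin 3) T3 (N + 1)) : ℝ :=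
  ((∑ k : Fin 3, (u c.time c.fstPos k / θ c.time c.fstPos - u c.time c.sndPos k / θ c.time c.sndPos) *
      (c.postVel.1 k - c.preVel.1 k)) -
    ((θ c.time c.fstPos)⁻¹ - (θ c.time c.sndPos)⁻¹) * ((‖c.postVel.1‖ ^ 2 - ‖c.preVel.1‖ ^ 2) / 2)) / 2

end Defs

/-! ## Slices of jointly smooth fields along free flight on `𝕋³` -/

section TorusSlices

variable {S : Set ℝ}

/-- Along a free flight `s ↦ x₀ + proj ((s - t₀) v)`, a field whose space–time lift is continuous on
`S × ℝ³` is continuous in time on `S`. [folklore] -/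
theorem continuousOn_slice_freeFlight {F : Type*} [NormedAddCommGroup F] [NormedSpace ℝ F]
    {ψ : ℝ → T3 → F} (hψ : ContinuousOn (Torus.stLift ψ) (S ×ˢ univ)) (x₀ : T3) (v : V3) (t₀ : ℝ) :
    ContinuousOn (fun s => ψ s (x₀ + Torus.proj ((s - t₀) • v))) S := by
  obtain ⟨y₀, rfl⟩ := Torus.proj_surjective x₀
  have hℓ : Continuous fun s : ℝ => ((s, y₀ + (s - t₀) • v) : ℝ × V3) := by fun_prop
  have heq : (fun s => ψ s (Torus.proj y₀ + Torus.proj ((s - t₀) • v))) =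
      Torus.stLift ψ ∘ fun s : ℝ => ((s, y₀ + (s - t₀) • v) : ℝ × V3) := by
    funext s
    simp only [Function.comp_apply, Torus.stLift_apply, Torus.proj_add]
  rw [heq]
  exact hψ.comp hℓ.continuousOn fun s hs => ⟨hs, mem_univ _⟩

/-- **The streaming chain rule for a slice.** For a real field `ψ` jointly smooth on `S × 𝕋³` (`S` of
unique differentiability) and a time `t` with `S ∈ 𝓝 t`, along the free flight `s ↦ x₀ + proj((s - t₀)v)`
the function `s ↦ ψ s (x₀ + proj((s - t₀)v))` has derivative `∂ₜψ + Σ_k v_k ∂_k ψ` at `s = t`, with the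
tree's `Torus.timeDerivWithin S` and `Torus.partialDeriv` (`d/ds = ∂ₛ + v·∇` through the space–time lift;
at interior times the one-sided time derivative is the two-sided one). [folklore] -/
theorem hasDerivAt_slice_freeFlight {ψ : ℝ → T3 → ℝ} (hψ : Torus.IsSmoothSpaceTimeOn S ψ)
    (hS : UniqueDiffOn ℝ S) {t : ℝ} (ht : S ∈ 𝓝 t) (x₀ : T3) (v : V3) (t₀ : ℝ) :
    HasDerivAt (fun s => ψ s (x₀ + Torus.proj ((s - t₀) • v)))
      (Torus.timeDerivWithin S ψ t (x₀ + Torus.proj ((t - t₀) • v)) +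
        ∑ k : Fin 3, v k * Torus.partialDeriv k (ψ t) (x₀ + Torus.proj ((t - t₀) • v))) t := by
  obtain ⟨y₀, rfl⟩ := Torus.proj_surjective x₀
  have htS : t ∈ S := mem_of_mem_nhds ht
  have hℓ : HasDerivAt (fun s : ℝ => ((s, y₀ + (s - t₀) • v) : ℝ × V3)) ((1 : ℝ), v) t := by
    have h2 : HasDerivAt (fun s : ℝ => y₀ + (s - t₀) • v) v t := by
      simpa using (((hasDerivAt_id t).sub_const t₀).smul_const v).const_add y₀
    exact (hasDerivAt_id t).prodMk h2
  have heq : (fun s => ψ s (Torus.proj y₀ + Torus.proj ((s - t₀) • v))) =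
      Torus.stLift ψ ∘ fun s : ℝ => ((s, y₀ + (s - t₀) • v) : ℝ × V3) := by
    funext s
    simp only [Function.comp_apply, Torus.stLift_apply, Torus.proj_add]
  have hnhds : S ×ˢ (univ : Set V3) ∈ 𝓝 ((t, y₀ + (t - t₀) • v) : ℝ × V3) :=
    prod_mem_nhds ht univ_mem
  have hdiff : HasFDerivAt (Torus.stLift ψ) (fderiv ℝ (Torus.stLift ψ) (t, y₀ + (t - t₀) • v))
      (t, y₀ + (t - t₀) • v) :=
    ((hψ.contDiffAt hnhds).differentiableAt (by simp)).hasFDerivAt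
  rw [heq]
  refine (hdiff.comp_hasDerivAt t hℓ).congr_deriv ?_
  have hsplit : ((1 : ℝ), v) = ((1 : ℝ), (0 : V3)) + ((0 : ℝ), v) := by simp
  rw [hsplit, map_add, ← fderivWithin_of_mem_nhds hnhds, ← Torus.proj_add]
  congr 1
  · exact (hψ.timeDerivWithin_apply_proj hS htS _).symm
  · rw [← hψ.fderiv_slice_apply htS,
      Torus.fderiv_apply_eq_sum_partialDeriv ((hψ.isSmooth_slice htS).isContDiff (by simp))]
    simp only [smul_eq_mul]

end TorusSlices

/-! ## Ordered contact pairs at a binary collision on the torus -/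

section ContactPairs

variable {M : ℕ} {ε : ℝ}

/-- Contact is symmetric in the pair on the torus (the minimal-image distance is symmetric); a copy of
`Torus.mem_contactSet_comm` (`BilliardTensorDivFree`) to keep the imports light. [folklore] -/
theorem torus_mem_contactSet_comm {i j : Fin M} {z : Config M (Fin 3) T3} :
    z ∈ contactSet (Torus.geometry (Fin 3)) M ε i j ↔ z ∈ contactSet (Torus.geometry (Fin 3)) M ε j i := by
  simp only [mem_contactSet, Torus.norm_geometry_sepVec, Torus.euclidDist_comm (z i).1]

/-- On the torus the ordered contact pairs of a hard-sphere trajectory at a collision of `(p, q)` are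
`(p, q)` and `(q, p)` (collisions are binary; no regularity of the geometry is needed). [folklore] -/
theorem torus_contactPairs_eq_pair {γ : ℝ → Config M (Fin 3) T3}
    (h : IsHardSphereTrajectory (Torus.geometry (Fin 3)) ε M γ) {t : ℝ} {p q : Fin M}
    (hpq : (p, q) ∈ contactPairs (Torus.geometry (Fin 3)) ε (γ t)) :
    contactPairs (Torus.geometry (Fin 3)) ε (γ t) = {(p, q), (q, p)} := by
  have hqp : (q, p) ∈ contactPairs (Torus.geometry (Fin 3)) ε (γ t) :=
    mem_contactPairs.2 ⟨(mem_contactPairs.1 hpq).1.symm, torus_mem_contactSet_comm.1 (mem_contactPairs.1 hpq).2⟩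
  ext e
  rw [Finset.mem_insert, Finset.mem_singleton]
  exact ⟨h.eq_or_eq_of_mem_contactPairs hpq, by rintro (rfl | rfl) <;> assumption⟩

end ContactPairs

/-! ## Joint smoothness of the slices of the exponent -/

section Smooth

variable {T : ℝ} {a θ : ℝ → T3 → ℝ} {u : ℝ → T3 → V3}

/-- For every frozen velocity `v` the slice `(t, x) ↦ g_t(x, v)` is jointly smooth on `[0, T) × 𝕋³`
(`log` of positive smooth fields, division by `2θ > 0`). [folklore] -/
theorem isSmoothSpaceTimeOn_gExp (ha : Torus.IsSmoothSpaceTimeOn (Ico 0 T) a)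
    (hθ : Torus.IsSmoothSpaceTimeOn (Ico 0 T) θ) (hu : Torus.IsSmoothSpaceTimeOn (Ico 0 T) u)
    (ha0 : ∀ t ∈ Ico 0 T, ∀ x, 0 < a t x) (hθ0 : ∀ t ∈ Ico 0 T, ∀ x, 0 < θ t x) (v : V3) :
    Torus.IsSmoothSpaceTimeOn (Ico 0 T) (fun t x => gExp a θ u t (x, v)) := by
  have ha' : ∀ p ∈ Ico 0 T ×ˢ (univ : Set V3), Torus.stLift a p ≠ 0 := fun p hp =>
    (ha0 p.1 hp.1 (Torus.proj p.2)).ne'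
  have hθ' : ∀ p ∈ Ico 0 T ×ˢ (univ : Set V3), 2 * Real.pi * Torus.stLift θ p ≠ 0 := fun p hp =>
    (mul_pos (mul_pos two_pos Real.pi_pos) (hθ0 p.1 hp.1 (Torus.proj p.2))).ne'
  have hθ'' : ∀ p ∈ Ico 0 T ×ˢ (univ : Set V3), 2 * Torus.stLift θ p ≠ 0 := fun p hp =>
    (mul_pos two_pos (hθ0 p.1 hp.1 (Torus.proj p.2))).ne'
  have h1 := ContDiffOn.log ha ha'
  have h2 := ContDiffOn.log (contDiffOn_const.mul hθ) hθ'
  have h3 : ContDiffOn ℝ _ (fun p : ℝ × V3 => ‖v - Torus.stLift u p‖ ^ 2 / (2 * Torus.stLift θ p))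
      (Ico 0 T ×ˢ univ) :=
    (ContDiffOn.norm_sq ℝ ((contDiffOn_const (c := v)).sub hu)).div (contDiffOn_const.mul hθ) hθ''
  show ContDiffOn ℝ _ (fun p : ℝ × V3 => Real.log (Torus.stLift a p) -
      3 / 2 * Real.log (2 * Real.pi * Torus.stLift θ p) -
      ‖v - Torus.stLift u p‖ ^ 2 / (2 * Torus.stLift θ p)) (Ico 0 T ×ˢ univ)
  exact (h1.sub (contDiffOn_const.mul h2)).sub h3

end Smooth

/-! ## The jump of the observable at a binary collision -/

section Jump

variable {N : ℕ}

/-- **The pair algebra.** If the two partners keep their positions, `v_p⁺ + v_q⁺ = v_p⁻ + v_q⁻` and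
`|v_p⁺|² + |v_q⁺|² = |v_p⁻|² + |v_q⁻|²`, the total jump of `g` over the pair is the pair kernel summed
over the two orders `(p, q)`, `(q, p)`. [folklore] -/
theorem jump_algebra (a θ : ℝ → T3 → ℝ) (u : ℝ → T3 → V3) (t : ℝ) {zp zq zpl zql : T3 × V3}
    (hp1 : zpl.1 = zp.1) (hq1 : zql.1 = zq.1) (hM : zp.2 + zq.2 = zpl.2 + zql.2)
    (hE : ‖zp.2‖ ^ 2 + ‖zq.2‖ ^ 2 = ‖zpl.2‖ ^ 2 + ‖zql.2‖ ^ 2) :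
    gExp a θ u t zp - gExp a θ u t zpl + (gExp a θ u t zq - gExp a θ u t zql) =
      ((∑ k : Fin 3, (u t zp.1 k / θ t zp.1 - u t zq.1 k / θ t zq.1) * (zp.2 k - zpl.2 k)) -
          ((θ t zp.1)⁻¹ - (θ t zq.1)⁻¹) * ((‖zp.2‖ ^ 2 - ‖zpl.2‖ ^ 2) / 2)) / 2 +
      ((∑ k : Fin 3, (u t zq.1 k / θ t zq.1 - u t zp.1 k / θ t zp.1) * (zq.2 k - zql.2 k)) -
          ((θ t zq.1)⁻¹ - (θ t zp.1)⁻¹) * ((‖zq.2‖ ^ 2 - ‖zql.2‖ ^ 2) / 2)) / 2 := by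
  obtain ⟨xp, A⟩ := zp
  obtain ⟨xq, C⟩ := zq
  obtain ⟨xp', B⟩ := zpl
  obtain ⟨xq', D⟩ := zql
  dsimp only at hp1 hq1 hM hE ⊢
  subst hp1 hq1
  have hM' : ∀ k, A k + C k = B k + D k := fun k => by
    simpa using congrArg (fun w : V3 => w k) hM
  simp only [gExp, norm_sub_sq_real, PiLp.inner_apply, RCLike.inner_apply, conj_trivial,
    Fin.sum_univ_three]
  linear_combination (-((θ t xp')⁻¹ + (θ t xq')⁻¹) / 4) * hE +
    (((θ t xp')⁻¹ * u t xp' 0 + (θ t xq')⁻¹ * u t xq' 0) / 2) * hM' 0 +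
    (((θ t xp')⁻¹ * u t xp' 1 + (θ t xq')⁻¹ * u t xq' 1) / 2) * hM' 1 +
    (((θ t xp')⁻¹ * u t xp' 2 + (θ t xq')⁻¹ * u t xq' 2) / 2) * hM' 2

variable {ε : ℝ} {γ : ℝ → Config (N + 1) (Fin 3) T3}

/-- **The jump of `Σ_i g_t(w_i)` at a collision time** is the pair kernel summed over the ordered contact
pairs — the colliding pair in its two orders (positions and the other particles do not jump; the
recorded pre-collisional velocity is the left limit; momentum and energy of the pair are conserved).
[folklore] -/
theorem collisionJump_gSum (hγ : IsHardSphereTrajectory (Torus.geometry (Fin 3)) ε (N + 1) γ)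
    (a θ : ℝ → T3 → ℝ) (u : ℝ → T3 → V3) {tc : ℝ} (htc : tc ∈ collisionTimes (Torus.geometry (Fin 3)) ε γ) :
    collisionJump (gSum a θ u tc) γ tc =
      ∑ p ∈ contactPairs (Torus.geometry (Fin 3)) ε (γ tc),
        pairKernel θ u (HardSphereCollisionRecord.ofConfig (Torus.geometry (Fin 3)) ε (γ tc) tc p.1 p.2) := by
  obtain ⟨p, q, hpq, hc⟩ := htc
  have hpq_mem : (p, q) ∈ contactPairs (Torus.geometry (Fin 3)) ε (γ tc) := mem_contactPairs.2 ⟨hpq, hc⟩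
  have hqp_mem : (q, p) ∈ contactPairs (Torus.geometry (Fin 3)) ε (γ tc) :=
    mem_contactPairs.2 ⟨hpq.symm, torus_mem_contactSet_comm.1 hc⟩
  have hne : (p, q) ≠ (q, p) := fun he => hpq (Prod.mk.inj he).1
  rw [torus_contactPairs_eq_pair hγ hpq_mem, Finset.sum_pair hne, collisionJump, gSum, gSum,
    ← Finset.sum_sub_distrib, Fintype.sum_eq_add p q hpq]
  · have hvp : (HardSphereCollisionRecord.ofConfig (Torus.geometry (Fin 3)) ε (γ tc) tc p q).preVel.1 =
        (Function.leftLim γ tc p).2 := by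
      rw [hγ.ofConfig_preVel_eq_leftLim hpq_mem]
    have hvq : (HardSphereCollisionRecord.ofConfig (Torus.geometry (Fin 3)) ε (γ tc) tc q p).preVel.1 =
        (Function.leftLim γ tc q).2 := by
      rw [hγ.ofConfig_preVel_eq_leftLim hqp_mem]
    simp only [pairKernel, HardSphereCollisionRecord.ofConfig_time, HardSphereCollisionRecord.ofConfig_fstPos,
      HardSphereCollisionRecord.ofConfig_sndPos, HardSphereCollisionRecord.ofConfig_postVel, hvp, hvq]
    exact jump_algebra a θ u tc (hγ.leftLim_apply_fst torus_continuous_translate tc p)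
      (hγ.leftLim_apply_fst torus_continuous_translate tc q) (hγ.vel_add_vel_eq_leftLim hpq hc)
      (hγ.norm_sq_vel_add_eq_leftLim hpq hc)
  · intro k hk
    rw [hγ.apply_eq_leftLim_apply_of_ne hpq hc hk.1 hk.2, sub_self]

end Jump

/-! ## The balance law for the exponent along a good orbit -/

section Orbit

variable {σ T : ℝ} {N : ℕ} {a θ : ℝ → T3 → ℝ} {u : ℝ → T3 → V3}

/-- **Pathwise entropy production** (named form): for profiles `a, θ > 0`, `u` jointly smooth on `[0, T)`,
a good datum `z` and a window `[s, s+h] ⊆ [0, T)`,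
`F_{s+h}(Φ_{s+h} z) − F_s(Φ_s z) = ∫_s^{s+h} F'_r(Φ_r z) dr + collisionSum_{(s, s+h]} pairKernel`. [folklore] -/
theorem gSum_sub_eq (Φ : HardSphereFlow (Torus.geometry (Fin 3)) (hsDiameter σ N) (N + 1))
    (ha : Torus.IsSmoothSpaceTimeOn (Ico 0 T) a) (hθ : Torus.IsSmoothSpaceTimeOn (Ico 0 T) θ)
    (hu : Torus.IsSmoothSpaceTimeOn (Ico 0 T) u) (ha0 : ∀ t ∈ Ico 0 T, ∀ x, 0 < a t x)
    (hθ0 : ∀ t ∈ Ico 0 T, ∀ x, 0 < θ t x) {z : Config (N + 1) (Fin 3) T3} (hz : z ∈ Φ.good) {s h : ℝ}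
    (hs : 0 ≤ s) (hh : 0 ≤ h) (hshT : s + h < T) :
    gSum a θ u (s + h) (Φ.flow (s + h) z) - gSum a θ u s (Φ.flow s z) =
      (∫ r in s..(s + h), DgSum T a θ u r (Φ.flow r z)) +
        Φ.collisionSum (Ioc s (s + h)) (pairKernel θ u) z := by
  have htraj := Φ.isTrajectory z hz
  have hU : UniqueDiffOn ℝ (Ico 0 T) := uniqueDiffOn_Ico 0 T
  have hIcc : Icc s (s + h) ⊆ Ico 0 T := fun r hr => ⟨hs.trans hr.1, hr.2.trans_lt hshT⟩
  have hg := fun v : V3 => isSmoothSpaceTimeOn_gExp ha hθ hu ha0 hθ0 v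
  -- the analytic inputs of the localized balance law for `F = gSum`, `F' = DgSum`
  have hF : ∀ (w : Config (N + 1) (Fin 3) T3) (t₀ : ℝ), ∀ r ∈ Ioo s (s + h),
      HasDerivAt (fun r => gSum a θ u r (freeFlight (Torus.geometry (Fin 3)) (r - t₀) w))
        (DgSum T a θ u r (freeFlight (Torus.geometry (Fin 3)) (r - t₀) w)) r := by
    intro w t₀ r hr
    have hrS : Ico 0 T ∈ 𝓝 r :=
      mem_of_superset (Ioo_mem_nhds (hs.trans_lt hr.1) (hr.2.trans hshT)) Ioo_subset_Ico_self
    simp only [gSum, DgSum, DgExp, freeFlight_apply, Torus.geometry_translate]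
    exact HasDerivAt.fun_sum fun i _ => hasDerivAt_slice_freeFlight (hg (w i).2) hU hrS (w i).1 (w i).2 t₀
  have hFc : ∀ (w : Config (N + 1) (Fin 3) T3) (t₀ : ℝ),
      ContinuousOn (fun r => gSum a θ u r (freeFlight (Torus.geometry (Fin 3)) (r - t₀) w)) (Icc s (s + h)) := by
    intro w t₀
    simp only [gSum, freeFlight_apply, Torus.geometry_translate]
    exact continuousOn_finsetSum _ fun i _ =>
      (continuousOn_slice_freeFlight (hg (w i).2).continuousOn_stLift (w i).1 (w i).2 t₀).mono hIcc
  have hF'c : ∀ (w : Config (N + 1) (Fin 3) T3) (t₀ : ℝ),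
      ContinuousOn (fun r => DgSum T a θ u r (freeFlight (Torus.geometry (Fin 3)) (r - t₀) w)) (Icc s (s + h)) := by
    intro w t₀
    simp only [DgSum, DgExp, freeFlight_apply, Torus.geometry_translate]
    refine continuousOn_finsetSum _ fun i _ => ContinuousOn.mono ?_ hIcc
    refine (continuousOn_slice_freeFlight ((hg (w i).2).timeDerivWithin hU).continuousOn_stLift
      (w i).1 (w i).2 t₀).add (continuousOn_finsetSum _ fun k _ => continuousOn_const.mul ?_)
    exact continuousOn_slice_freeFlight ((hg (w i).2).partialDeriv hU k).continuousOn_stLift (w i).1 (w i).2 t₀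
  obtain ⟨-, hbal⟩ := sub_eq_integral_add_finsum_collisionJump_loc htraj torus_continuous_translate hF hFc
    (fun w t₀ => (hF'c w t₀).intervalIntegrable_of_Icc (le_add_of_nonneg_right hh)) le_rfl
    (le_add_of_nonneg_right hh) le_rfl
  rw [hbal]
  congr 1
  -- the jump sum is the collision sum of the pair kernel
  rw [HardSphereFlow.collisionSum_eq, collisionSum_eq_collisionPairSum, collisionPairSum]
  refine finsum_mem_congr rfl fun tc htc => ?_
  exact collisionJump_gSum htraj a θ u htc.1

end Orbit

/-! ## The stub -/

/-- **STUB `stub_pathwise`** of line `IdeatorTwoSketch` (crux `ClampedCurrentsDock`, stmt-AtomisticToContinuum-14680):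
pathwise entropy production in `collisionSum` form along a good orbit of the hard-sphere flow (`gSum_sub_eq`).
[folklore] -/
theorem stub_pathwise : PathwiseEntropyProduction := by
  intro σ T N Φ a θ u _ _ ha hθ hu ha0 hθ0 z hz s h hs hh hshT
  exact gSum_sub_eq Φ ha hθ hu ha0 hθ0 hz hs hh hshT

end Summit.AtomisticToContinuum.HydrodynamicLimit.Theorems.ClampedCurrentsDockPathwise

end
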